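import Literature.AlgebraicGeometry.HodgeTheory.SemiregularVariationalHodgeISemiregularModel
import Literature.AlgebraicGeometry.HodgeTheory.SemiregularVariationalHodgeTwisted
import Literature.AlgebraicGeometry.KTheory.EulerCharacteristic
import HarnessLib

/-!
# The semiregularity theorem for TWISTED PERFECT complexes: the `B`-field-twisted object class and its local
# variational Hodge statement (Pridham 2024 Rem. 2.26; Markman 2025 Conj. 7.3.9 / §7.5.2; Perry 2026 Thm. 1.1)

Family `hodge`, layer `Literature/AlgebraicGeometry/HodgeTheory`. VOCABULARY (`def`s with bodies) and ONE NAMED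
FACT (D-0014, `TwistedPerfectDoorVHC`), requested by the definition items `defn-twistedReflexiveClass` (D1) and
`defn-TwistedPerfectDoorVHC` (D2) of road b02 (`Summits/HodgeConjecture/HodgeConjecture/Theses/VHCAbelianSchemesRoad.lean`,
ruling A1): the door through which the ONLY carriers in print inside the known regime of the Hodge conjecture for
abelian varieties of Weil type — Markman's semiregular REFLEXIVE secant sheaves, twisted by a `μ_r`-cocycle with trivial
determinant (arXiv:2502.03415, Lemma 9.3.6, §7.3–7.5) — enter the tree's door-agnostic variational machinery
(`ObjClass := ℕ → (X₀ : SchemeOver ℂ) → Finset ℕ → (∀ p, H^{2p}(X₀(ℂ); ℂ)) → Prop`,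
`Summits/Ventures/HSemireg/AmplificationChainAssembly.lean`; the type is spelled out here, Literature importing no Summits file).

## Sources, verbatim

* [Perry2026Semiregularity] (arXiv:2604.00511, UNREFEREED) Thm. 1.1: «Let `f : X → S` be a smooth proper family of complex
  varieties. Let `0 ∈ S(ℂ)` be a point and let `E_0 ∈ D_perf(X_0)` be a semiregular perfect complex with
  `Ext^{<0}(E_0, E_0) = 0`. Assume that `B_0 ∈ H²(X_0, ℚ(1))` is an algebraic class such that
  `w_0 = exp(B_0) · ch(E_0) ∈ ⊕_{k ≥ 0} H^{2k}(X_0, ℚ(k))` remains Hodge along `S` […]. Then: (1) `E_0` deforms as a twisted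
  perfect complex over an étale neighborhood of `0` […] (2) The class `w_0` remains algebraic along `S`.» (Def. 2.4 / Rem. 2.5:
  semiregular = the Buchweitz–Flenner map `σ : Ext²(E,E) → ⊕_q H^{q+2}(X, Ω^q)` injective.)
* [Pridham2024Semiregularity] (Forum Math. Sigma 12 (2024) e126, REFEREED) Cor. 2.25 (perfect complex `ℱ` on `X ⊗_A B`, `A ↠ B`
  square-zero, `X` smooth proper over Artinian `A`: «the image of the Chern character `ch_p(ℱ)` […] lies in `F^p H^{2p}(X, Ω^•_{X/A})`
  if and only if `o(ℱ)` maps to zero under […] `σ_{p-1}`»), Rem. 2.27 (reduced obstruction theory `ker σ` on the Hodge locus),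
  and Rem. 2.26: «Since `μ_r`-twisted perfect complexes on `X` (i.e., maps `X → [Perf/Bμ_r]`) give rise to perfect complexes
  on such gerbes, replacing `X` with `X̃_α` in Corollaries 2.24 and 2.25 immediately extends their conclusions to `μ_r`-twisted
  perfect complexes `ℱ` on `X′` with twist `[α] ∈ H²_ét(X′, μ_r)`.»
* [Markman2025SecantWeil] (arXiv:2502.03415, UNREFEREED) §1.1 `κ(E) := ch(E) · exp(-c₁(E)/rk E)`; §7.3 p. 37: «Note that
  `ch(𝓑)` remains of Hodge type, if and only if both `c₁(𝓑)` and `κ(𝓑)` remain of Hodge type […] replace `𝓑` with a twisted sheaf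
  `𝓑′` with trivial determinant […] `κ(𝓑′) = ch(𝓑′)`»; Conj. 7.3.9 (semiregular `μ_r`-twisted coherent sheaf whose `ch` stays
  Hodge extends to a twisted sheaf over `π⁻¹(U)`), PROVED for families of abelian varieties in §7.5.2; p. 6 footnote: «One
  needs to verify that our semiregularity map is injective, if and only if Pridham's is» (UNVERIFIED comparison); Lemma 9.3.6
  (the semiregular twisted REFLEXIVE sheaf `𝓑`, locally free over `Y₀` only).
* [HuybrechtsStellari2005] §1: `ch^B(E) = ch(E) · exp(B)`.
* [Fulton1998] §15.1 / Example 3.2.3 (`ch` on `K(X)`); [Schlichting2011HigherKTheory] Exercise 3.1.4 (`K₀(D^b Vect X) = K₀(X)`).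

## Design (the filer's call recorded for the reviewer; vhodge-lit §124.c (iii)/(124.d))

1. PACKAGING OF THE TWIST. On the special fibre `X₀` the datum is Perry's: an UNTWISTED perfect complex `E₀` and a
   rational ALGEBRAIC `B`-field `B₀ ∈ H²(X₀(ℂ); ℂ)`, with classes `κ = exp(B₀) ∪ ch(E₀)`; the twist lives in the
   deformation/conclusion, not in the anchor datum. Markman's packaging «`μ_r`-twisted sheaf `𝓑′ = E ⊗ det(E)^{-1/r}` with trivial
   determinant, `ch(𝓑′) = κ(E)`» is the case `B₀ = -c₁(E)/r` (rational, algebraic by Lefschetz (1,1)).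
2. PERFECT = STRICTLY PERFECT. `E₀` is a bounded complex of vector bundles on `X₀` (`KTheory.IsBoundedVBComplex`); on the
   smooth projective `X₀` every coherent (e.g. REFLEXIVE) sheaf has a finite locally free resolution
   (`Modules/StrictlyPerfectResolution.lean`), so Markman's reflexive carriers are hosted; its Chern character is `chPerfect`
   (§1: `ch_k(E•) = ch_k(χ(E•))` through `K₀(X₀)`, invariant under quasi-isomorphism).
3. SEMIREGULARITY IS A SCHEMA PARAMETER `Adm : PerfectAdmissibility` («`E` is admissible in relative dimension `n` for the
   degrees `I`»). The INTENDED notion — `(σ_q(E))_{q+1 ∈ I}` jointly injective on `Ext²_{D(X₀)}(E, E)` (BF Def. 4.1 for a perfect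
   complex; Perry Def. 2.4), `Ext^{<0}(E,E) = 0` — has a kernel carrier only on the VENTURE side of the tree
   (`Summits/Ventures/HSemireg/HomComplexSigma.lean`: `HomComplex.IsISemiregularC`, notion `gluableSigmaAdmissible`), which a
   Literature file cannot import; the Literature layer's `σ` (`sigmaHigher`, `IsISemiregular`) is for finite locally free MODULES.
   Exactly as the venture's untwisted perfect door (`Summits/Ventures/HSemireg/PerfectComplexDoor.lean`, `perfectObjClass C Adm`),
   the object class and the fact below are therefore SCHEMATA in `Adm`, with ONE TYPED notion here: `bfSingleAdmissible`
   (an `I`-semiregular finite locally free sheaf placed in degree `0`), for which the `B₀ = 0` slice of the class is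
   Buchweitz–Flenner's. A consumer's theorem is exactly as strong as the notion it is fed; summit-side users instantiate
   `Adm` with the venture's `σ`-notion (or a disjunction containing `bfSingleAdmissible`, to inherit §3's inclusions).
   -- TODO(general form): a Literature-level `σ` for strictly perfect complexes (re-home the venture's `HomComplexSigma` stack),
   -- after which `Adm` is fixed to «`IsISemiregularC … {q | q+1 ∈ I}` ∧ `Ext^{<0} = 0`» and the schema disappears.
4. `chKZero` / `chPerfect` (§1) are the Literature homes of the venture's declarations of the same names and bodies
   (`Summit.Ventures.HSemireg.chKZero` / `chPerfect`, `PerfectComplexDoor.lean` §1, adapted verbatim) — known mathematics belongs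
   in this layer; the venture copies can be re-pointed (definitionally equal).

## Contents

§1 `chKZero`, `chPerfect` (+ `_of`, naturality, rationality, algebraicity on smooth projective `X`, alternating sum, degree-`0`
complexes, iso/quasi-iso invariance). §2 `expTwistClasses X B κ k = Σ_{i ≤ k} (1/i!) Bⁱ ∪ κ_{k-i}` (generic `B`-twist of a
family of even classes; `expTwistCh C X B E = expTwistClasses X B (ch E)` by `rfl`; `B = 0` gives `κ` back; rationality).
§3 `PerfectAdmissibility`, `twistedReflexiveClass C Adm` (D1), monotonicity in `Adm`, the untwisted slice, `bfSingleAdmissible`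
and the inclusions «`I`-semiregular vector bundle (+ `B`-field) ⟹ member». §4 the named fact `TwistedPerfectDoorVHC C Adm` (D2)
— VERBATIM the binders of `BuchweitzFlenner2003_variationalHodge_ISemiregular_model` / of the venture's
`LocalVariationalHodgeFor 𝒪` at `𝒪 := twistedReflexiveClass C Adm` (so summit-side `TwistedPerfectDoorVHC C Adm ↔
LocalVariationalHodgeFor (twistedReflexiveClass C Adm)` holds by `Iff.rfl`) — and its antitonicity in `Adm`.

## What is NOT here

No assertion that any variational statement HOLDS; no `σ` of a complex; no gerbe / Azumaya algebra / Brauer class (the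
`B`-field packaging only: twists whose class lies in the image of `H²(X₀, ℚ)`, which is all of them on an abelian variety,
`H³(A, ℤ)` being torsion-free — Markman §7.5); Perry's conclusion (1) (the twisted deformation itself); the equivariant theory.
-/

noncomputable section

open CategoryTheory CategoryTheory.Limits AlgebraicGeometry
open _root_.Topology _root_.Filter
open Literature.AlgebraicTopology.SingularHomology
open Literature.AlgebraicGeometry.KTheory

namespace Literature.AlgebraicGeometry.HodgeTheory

open Literature.AlgebraicGeometry.Motives

/-! ### §1 The Chern character on `K₀(X)` and of a bounded complex of vector bundles -/

section ChernCharacter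

variable (C : ChernCharacterBetti) (X : SchemeOver ℂ)

/-- **The Chern character on the Grothendieck group of vector bundles**, degree `k`:
`ch_k : K₀(X) →+ H^{2k}(X(ℂ); ℂ)`, `[E] ↦ ch_k(E)` — well defined by the additivity of `ch` on short exact
sequences of vector bundles («`ch : K(X) → A(X)_ℚ` determined by the following properties […]»; the tree's
`KTheory.KZero.lift`). Literature home of the venture declaration `Summit.Ventures.HSemireg.chKZero` (same body).
[cite: Fulton1998, §15.1 and Example 3.2.3] -/
def chKZero (k : ℕ) : KZero X.left →+ complexBetti X (2 * k) :=
  KZero.lift (fun E _ => C.ch X E k) fun S hS h₁ _ h₃ =>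
    C.ch_shortExact S hS h₁.isVectorBundle h₃.isVectorBundle k

/-- `ch_k([E]) = ch_k(E)` on the class of a vector bundle. [cite: Fulton1998, §15.1] -/
@[simp]
theorem chKZero_of (k : ℕ) (E : X.left.Modules) (hE : IsFiniteLocallyFree E) :
    chKZero C X k (KZero.of E hE) = C.ch X E k :=
  KZero.lift_of _ _ E hE

/-- **Naturality**: `f^*(ch_k(x)) = ch_k(f^* x)` for `x ∈ K₀(X)` (from `ch ∘ f^* = f^* ∘ ch` on vector bundles,
the generators of `K₀`). [cite: Fulton1998, §15.1 (ii)] -/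
theorem map_chKZero {Y : SchemeOver ℂ} (f : Y ⟶ X) (k : ℕ) (x : KZero X.left) :
    complexBetti.map f (2 * k) (chKZero C X k x) = chKZero C Y k (KZero.map f.left x) := by
  induction x using KZero.induction_on with
  | zero => simp only [map_zero]
  | of E hE => rw [chKZero_of, KZero.map_of, chKZero_of]; exact C.map_ch f E hE.isVectorBundle k
  | neg x hx => simp only [map_neg, hx]
  | add x y hx hy => simp only [map_add, hx, hy]

/-- Every class `ch_k(x)`, `x ∈ K₀(X)`, is rational (the generators' are). [cite: VoisinHodgeI2002, Thm. 11.23] -/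
theorem isRationalClass_chKZero (k : ℕ) (x : KZero X.left) : IsRationalClass (chKZero C X k x) := by
  induction x using KZero.induction_on with
  | zero => rw [map_zero]; exact IsRationalClass.zero
  | of E hE => rw [chKZero_of]; exact C.isRationalClass_ch X E hE.isVectorBundle k
  | neg x hx =>
    rw [map_neg]
    have h := hx.smul (-1 : ℚ)
    rwa [Rat.cast_neg, Rat.cast_one, neg_one_smul] at h
  | add x y hx hy => rw [map_add]; exact hx.add hy

/-- On a smooth projective `X`, every class `ch_k(x)`, `x ∈ K₀(X)`, is ALGEBRAIC (`ch_k(E) ∈ N^k H^{2k}` for the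
generators; algebraic classes form a subgroup). [cite: Fulton1998, Prop. 19.1.2 and Cor. 19.2 (b)] -/
theorem chKZero_mem_algebraicClasses {n : ℕ} (hX : IsSmoothProjective n X) (k : ℕ) (x : KZero X.left) :
    chKZero C X k x ∈ algebraicClasses X k := by
  induction x using KZero.induction_on with
  | zero => rw [map_zero]; exact Submodule.zero_mem _
  | of E hE => rw [chKZero_of]; exact C.ch_mem_algebraicClasses hX E hE.isVectorBundle k
  | neg x hx => rw [map_neg]; exact Submodule.neg_mem _ hx
  | add x y hx hy => rw [map_add]; exact Submodule.add_mem _ hx hy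

/-- **The Chern character of a bounded complex of vector bundles** (a strictly perfect complex), degree `k`:
`ch_k(E•) := ch_k(χ(E•))`, `χ(E•) = Σ_i (-1)^i [E^i] ∈ K₀(X)` the tree's `KTheory.eulerChar` — the Chern character
of the class of the perfect complex in `K₀(X) = K₀(D^b Vect X)`. Literature home of the venture declaration
`Summit.Ventures.HSemireg.chPerfect` (same body). [cite: Fulton1998, §15.1] [cite: Schlichting2011HigherKTheory, Exercise 3.1.4] -/
def chPerfect (E : CochainComplex X.left.Modules ℤ) (hE : ∀ i, IsFiniteLocallyFree (E.X i)) (k : ℕ) :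
    complexBetti X (2 * k) :=
  chKZero C X k (eulerChar E hE)

/-- **Alternating-sum formula**: `ch_k(E•) = Σ_{i ∈ s} (-1)^i ch_k(E^i)` for any finite set `s` of degrees off
which the terms vanish. [cite: Fulton1998, §15.1 and Example 3.2.3] -/
theorem chPerfect_eq_sum (E : CochainComplex X.left.Modules ℤ) (hE : ∀ i, IsFiniteLocallyFree (E.X i))
    (s : Finset ℤ) (hs : ∀ i ∉ s, IsZero (E.X i)) (k : ℕ) :
    chPerfect C X E hE k = ∑ i ∈ s, ((i.negOnePow : ℤˣ) : ℤ) • C.ch X (E.X i) k := by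
  rw [chPerfect, eulerChar_eq_sum hE s hs, map_sum]
  refine Finset.sum_congr rfl fun i _ => ?_
  rw [map_zsmul, chKZero_of]

/-- **A complex concentrated in degree `0`**: if every term off degree `0` is a zero object then
`ch_k(E•) = ch_k(E⁰)`. [cite: Fulton1998, Example 3.2.3] -/
theorem chPerfect_eq_ch_zero (E : CochainComplex X.left.Modules ℤ) (hE : ∀ i, IsFiniteLocallyFree (E.X i))
    (h0 : ∀ i : ℤ, i ≠ 0 → IsZero (E.X i)) (k : ℕ) : chPerfect C X E hE k = C.ch X (E.X 0) k := by
  rw [chPerfect_eq_sum C X E hE {0} (fun i hi => h0 i (by simpa using hi)) k, Finset.sum_singleton,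
    Int.negOnePow_zero, Units.val_one, one_smul]

/-- **`ch(E₀[0]) = ch(E₀)`** for a vector bundle `E₀` placed in degree `0`. [cite: Fulton1998, Example 3.2.3] -/
theorem chPerfect_single (E₀ : X.left.Modules) (hE₀ : IsFiniteLocallyFree E₀)
    (h : ∀ i, IsFiniteLocallyFree (((HomologicalComplex.single _ (ComplexShape.up ℤ) 0).obj E₀).X i)) (k : ℕ) :
    chPerfect C X ((HomologicalComplex.single _ (ComplexShape.up ℤ) 0).obj E₀) h k = C.ch X E₀ k := by
  rw [chPerfect, eulerChar_single E₀ hE₀ 0 h, Int.negOnePow_zero, Units.val_one, one_smul, chKZero_of]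

/-- `ch_k(E•)` depends only on the terms (degreewise isomorphic complexes, whatever their differentials, have
the same Chern character: `ch` is defined on isomorphism classes in `K°X`). [cite: Fulton1998, §15.1 (definition of `K°X`)] -/
theorem chPerfect_eq_of_iso {E F : CochainComplex X.left.Modules ℤ} (hE : ∀ i, IsFiniteLocallyFree (E.X i))
    (hF : ∀ i, IsFiniteLocallyFree (F.X i)) (e : ∀ i, E.X i ≅ F.X i) (k : ℕ) :
    chPerfect C X E hE k = chPerfect C X F hF k := by
  rw [chPerfect, chPerfect, eulerChar_eq_of_iso hE hF e]

/-- **Invariance under quasi-isomorphism**: quasi-isomorphic bounded complexes of vector bundles have the same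
Chern character — `ch` is an invariant of the PERFECT COMPLEX (its class in `K₀(D^b Vect X) = K₀(X)`), not of the
chosen locally free model (the tree's PROVED `eulerChar_eq_of_quasiIso`).
[cite: Schlichting2011HigherKTheory, Exercise 3.1.4] [cite: Fulton1998, §15.1] -/
theorem chPerfect_eq_of_quasiIso {E F : CochainComplex X.left.Modules ℤ} (hE : IsBoundedVBComplex E)
    (hF : IsBoundedVBComplex F) (φ : E ⟶ F) [QuasiIso φ] (k : ℕ) :
    chPerfect C X E hE.isFiniteLocallyFree k = chPerfect C X F hF.isFiniteLocallyFree k := by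
  rw [chPerfect, chPerfect, hE.eulerChar_eq_of_quasiIso hF φ]

/-- **Compatibility with pull-back**: `f^*(ch_k(E•)) = ch_k(f^*E•)` for the termwise (= derived, the terms being
flat) pull-back of a bounded complex of vector bundles. [cite: Fulton1998, §15.1 (ii)] -/
theorem map_chPerfect {Y : SchemeOver ℂ} (f : Y ⟶ X) {E : CochainComplex X.left.Modules ℤ}
    (hE : IsBoundedVBComplex E) (k : ℕ) :
    complexBetti.map f (2 * k) (chPerfect C X E hE.isFiniteLocallyFree k) =
      chPerfect C Y (((Scheme.Modules.pullback f.left).mapHomologicalComplex _).obj E)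
        (hE.pullback f.left).isFiniteLocallyFree k := by
  rw [chPerfect, chPerfect, map_chKZero, map_eulerChar f.left hE]

/-- The Chern character of a complex of vector bundles is a rational class. [cite: VoisinHodgeI2002, Thm. 11.23] -/
theorem isRationalClass_chPerfect (E : CochainComplex X.left.Modules ℤ) (hE : ∀ i, IsFiniteLocallyFree (E.X i))
    (k : ℕ) : IsRationalClass (chPerfect C X E hE k) :=
  isRationalClass_chKZero C X k _

/-- **The Chern character of a complex of vector bundles on a smooth projective variety is an ALGEBRAIC class.**
[cite: Fulton1998, Prop. 19.1.2 and Cor. 19.2 (b)] -/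
theorem chPerfect_mem_algebraicClasses {n : ℕ} (hX : IsSmoothProjective n X) (E : CochainComplex X.left.Modules ℤ)
    (hE : ∀ i, IsFiniteLocallyFree (E.X i)) (k : ℕ) : chPerfect C X E hE k ∈ algebraicClasses X k :=
  chKZero_mem_algebraicClasses C X hX k _

end ChernCharacter

/-! ### §2 The `B`-twist `exp(B) ∪ κ` of a family of even-degree classes -/

section ExpTwist

variable (X : SchemeOver ℂ)

/-- **The `B`-twist of a family of even-degree classes**, degree `2k`: `(exp(B) ∪ κ)_k = Σ_{i=0}^{k} (1/i!) Bⁱ ∪ κ_{k-i}`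
for a class `B ∈ H²(X(ℂ); ℂ)` (a «`B`-field») and classes `κ_j ∈ H^{2j}(X(ℂ); ℂ)` — the operation `ch ↦ ch^B = ch · exp(B)`
of Huybrechts–Stellari / the class «`w_0 = exp(B_0) · ch(E_0)`» of Perry's Thm. 1.1, written for an arbitrary family `κ`
so that it applies alike to `ch` of a module (`expTwistCh C X B E = expTwistClasses X B (C.ch X E ·)`, `rfl`) and to `ch` of
a perfect complex (`chPerfect`). [cite: HuybrechtsStellari2005, §1 (twisted Chern character)] [cite: Perry2026Semiregularity, Thm. 1.1] -/
def expTwistClasses (B : complexBetti X 2) (κ : (j : ℕ) → complexBetti X (2 * j)) (k : ℕ) : complexBetti X (2 * k) :=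
  ∑ i : Fin (k + 1), ((Nat.factorial (i : ℕ) : ℕ) : ℂ)⁻¹ •
    cupProduct (two_mul_add_two_mul_sub i.2) (cupPowTwo B i) (κ (k - i))

/-- The tree's `B`-twisted Chern character of a module IS the `B`-twist of its Chern character family (same formula).
[cite: HuybrechtsStellari2005, §1] -/
theorem expTwistCh_eq_expTwistClasses (C : ChernCharacterBetti) (B : complexBetti X 2) (E : X.left.Modules) (k : ℕ) :
    expTwistCh C X B E k = expTwistClasses X B (fun j => C.ch X E j) k :=
  rfl

/-- **`B = 0`: the `0`-twist is the identity**, `(exp(0) ∪ κ)_k = κ_k` (only the term `i = 0` survives: `0ⁱ = 0` for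
`i ≥ 1`, `0⁰ = 1` and `1 ∪ x = x`). [cite: HuybrechtsStellari2005, §1] [folklore] -/
theorem expTwistClasses_zero (κ : (j : ℕ) → complexBetti X (2 * j)) (k : ℕ) : expTwistClasses X 0 κ k = κ k := by
  unfold expTwistClasses
  rw [Fin.sum_univ_succ, Finset.sum_eq_zero, add_zero]
  · show ((Nat.factorial 0 : ℕ) : ℂ)⁻¹ • cupProduct _ (cupPowTwo (0 : complexBetti X 2) 0) (κ (k - 0)) = κ k
    rw [Nat.factorial_zero, Nat.cast_one, inv_one, one_smul, cupPowTwo_zero]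
    show cupProduct (Nat.zero_add (2 * k)) (singularCohomology.one ℂ _) (κ k) = κ k
    exact one_cupProduct _
  · intro i _
    have h : cupPowTwo (0 : complexBetti X 2) ((i.succ : Fin (k + 1)) : ℕ) = 0 := by
      rw [Fin.val_succ, cupPowTwo_succ, map_zero]
    rw [h, LinearMap.map_zero₂, smul_zero]

/-- **Rationality**: if `B` and every `κ_j` are rational classes, so is every `(exp(B) ∪ κ)_k` (cup products, rational
multiples and sums of rational classes are rational). [cite: HatcherAT2002, §3.2] -/
theorem isRationalClass_expTwistClasses {B : complexBetti X 2} (hB : IsRationalClass B)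
    {κ : (j : ℕ) → complexBetti X (2 * j)} (hκ : ∀ j, IsRationalClass (κ j)) (k : ℕ) :
    IsRationalClass (expTwistClasses X B κ k) := by
  unfold expTwistClasses
  refine Finset.sum_induction _ (fun c => IsRationalClass c) (fun a b ha hb => ha.add hb) IsRationalClass.zero
    fun i _ => ?_
  have h : IsRationalClass (cupProduct (two_mul_add_two_mul_sub i.2) (cupPowTwo B i) (κ (k - i))) :=
    (hB.cupPowTwo i).cup _ (hκ _)
  have h' := h.smul ((Nat.factorial (i : ℕ) : ℚ)⁻¹)
  rwa [Rat.cast_inv, Rat.cast_natCast] at h'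

end ExpTwist

/-! ### §3 The object class of `B`-twisted admissible perfect complexes (definition item D1) -/

section ObjectClass

/-- **An admissibility (semiregularity) notion for perfect complexes** — the SCHEMA PARAMETER of this file (module
docstring, Design 3): a predicate `Adm n X₀ I E` on a relative dimension `n`, a `ℂ`-scheme `X₀`, a finite set `I` of Chern
degrees and a cochain complex `E` of `𝒪_{X₀}`-modules, read «`E` is a semiregular perfect complex for the degrees `I`».
INTENDED instance: `(σ_q(E))_{q+1 ∈ I}` jointly injective on `Ext²_{D(X₀)}(E, E)` and `Ext^{<0}(E, E) = 0` (BF Def. 4.1 for a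
perfect complex; Perry Def. 2.4 / Rem. 2.5 and the hypothesis of Thm. 1.1) — typed on the venture side of the tree only
(`Summit.Ventures.HSemireg.gluableSigmaAdmissible`, same type); TYPED instance here: `bfSingleAdmissible`.
[cite: BuchweitzFlenner2003, Def. 4.1 and §5 (I-semiregular)] [cite: Perry2026Semiregularity, Def. 2.4 and Rem. 2.5] -/
abbrev PerfectAdmissibility : Type 1 :=
  ∀ (_ : ℕ) (X₀ : SchemeOver ℂ), Finset ℕ → CochainComplex X₀.left.Modules ℤ → Prop

/-- **`twistedReflexiveClass C Adm` — the object class of `B`-TWISTED ADMISSIBLE PERFECT COMPLEXES** (definition item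
`defn-twistedReflexiveClass`, D1 of road b02; an `ObjClass` in the sense of the tree's door-agnostic variational machinery,
the type `ℕ → (X₀ : SchemeOver ℂ) → Finset ℕ → (∀ p, H^{2p}(X₀(ℂ); ℂ)) → Prop` spelled out):
`twistedReflexiveClass C Adm n X₀ I κ` ⟺ there are a bounded complex of vector bundles `E` on `X₀` (a strictly perfect
complex), ADMISSIBLE (`Adm n X₀ I E` — semiregular in the degrees `I`, for the intended `Adm`), and a RATIONAL, ALGEBRAIC
`B`-field `B₀ ∈ H²(X₀(ℂ); ℂ)` (`IsRationalClass B₀`, `B₀ ∈ N¹H²`: «an algebraic class `B_0 ∈ H²(X_0, ℚ(1))`»), such that for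
every `p ∈ I` the class `κ_p` is the degree-`2p` component of the `B₀`-twisted Chern character
`exp(B₀) ∪ ch(E•)` (`expTwistClasses X₀ B₀ (chPerfect C X₀ E ·) p`). This is EXACTLY the datum on the special fibre in
Perry's Thm. 1.1 («`E_0 ∈ D_perf(X_0)` semiregular […] `B_0` algebraic […] `w_0 = exp(B_0) · ch(E_0)`»), and it hosts Markman's
carriers — a semiregular REFLEXIVE sheaf `E` on an abelian variety, used through `κ(E) = ch(E) · exp(-c₁(E)/r)` (§1.1), i.e.
the `μ_r`-twisted sheaf `E ⊗ det(E)^{-1/r}` with trivial determinant of §7.3 / Lemma 9.3.6 — via a finite locally free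
resolution of `E` and `B₀ := -c₁(E)/r` (whence the item's name «twisted reflexive»). The `B₀ = 0`, single-sheaf slice is
Buchweitz–Flenner's class of `I`-semiregular vector bundles (`twistedReflexiveClass_of_isISemiregular`). SCHEMA in `Adm`
(module docstring, Design 3). [cite: Perry2026Semiregularity, Thm. 1.1 (hypotheses) and Def. 2.4]
[cite: Markman2025SecantWeil, §1.1 (κ-class), §7.3 and Lemma 9.3.6] [cite: HuybrechtsStellari2005, §1] -/
def twistedReflexiveClass (C : ChernCharacterBetti) (Adm : PerfectAdmissibility) (n : ℕ) (X₀ : SchemeOver ℂ)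
    (I : Finset ℕ) (κ : (p : ℕ) → complexBetti X₀ (2 * p)) : Prop :=
  ∃ (E : CochainComplex X₀.left.Modules ℤ) (hE : IsBoundedVBComplex E) (B₀ : complexBetti X₀ 2),
    Adm n X₀ I E ∧ IsRationalClass B₀ ∧ B₀ ∈ algebraicClasses X₀ 1 ∧
      ∀ p ∈ I, κ p = expTwistClasses X₀ B₀ (fun j => chPerfect C X₀ E hE.isFiniteLocallyFree j) p

variable {C : ChernCharacterBetti} {Adm Adm' : PerfectAdmissibility} {n : ℕ} {X₀ : SchemeOver ℂ} {I : Finset ℕ}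
  {κ : (p : ℕ) → complexBetti X₀ (2 * p)}

/-- **Monotonicity in the admissibility notion**: a WEAKER notion `Adm'` (more admissible complexes) gives a LARGER
object class (formal bookkeeping on the hypotheses of Perry's Thm. 1.1 with the semiregularity notion as a parameter).
[cite: Perry2026Semiregularity, Thm. 1.1 (hypotheses) and Def. 2.4] -/
theorem twistedReflexiveClass.mono (hle : ∀ n X₀ I E, Adm n X₀ I E → Adm' n X₀ I E)
    (h : twistedReflexiveClass C Adm n X₀ I κ) : twistedReflexiveClass C Adm' n X₀ I κ := by
  obtain ⟨E, hE, B₀, hA, hBr, hBa, hκ⟩ := h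
  exact ⟨E, hE, B₀, hle n X₀ I E hA, hBr, hBa, hκ⟩

/-- **The untwisted slice** (`B₀ = 0`, which is rational and algebraic): the Chern character family of an admissible bounded
complex of vector bundles lies in the class — the venture's untwisted perfect door `perfectObjClass C Adm` is contained in
`twistedReflexiveClass C Adm`. [cite: Perry2026Semiregularity, Thm. 1.1 (the case B₀ = 0)] -/
theorem twistedReflexiveClass_of_untwisted (E : CochainComplex X₀.left.Modules ℤ) (hE : IsBoundedVBComplex E)
    (hA : Adm n X₀ I E) (hκ : ∀ p ∈ I, κ p = chPerfect C X₀ E hE.isFiniteLocallyFree p) :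
    twistedReflexiveClass C Adm n X₀ I κ :=
  ⟨E, hE, 0, hA, IsRationalClass.zero, Submodule.zero_mem _, fun p hp => by rw [expTwistClasses_zero]; exact hκ p hp⟩

/-- The classes `κ_p`, `p ∈ I`, of a member of the class are RATIONAL (`B₀` and `ch(E•)` are). [cite: VoisinHodgeI2002, Thm. 11.23] -/
theorem twistedReflexiveClass.isRationalClass (h : twistedReflexiveClass C Adm n X₀ I κ) {p : ℕ} (hp : p ∈ I) :
    IsRationalClass (κ p) := by
  obtain ⟨E, hE, B₀, -, hBr, -, hκ⟩ := h
  rw [hκ p hp]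
  exact isRationalClass_expTwistClasses X₀ hBr (fun j => isRationalClass_chPerfect C X₀ E hE.isFiniteLocallyFree j) p

/-- **The TYPED admissibility notion of this layer — Buchweitz–Flenner's, for a vector bundle placed in degree `0`**:
`E` has zero terms off degree `0`, and its degree-`0` term is isomorphic to a finite locally free module `F` whose partial
semiregularity map `(σ_q)_{q+1 ∈ I}` is jointly injective (`IsISemiregular hF {q | q + 1 ∈ I}`, the tree's real Atiyah class and
trace, `SemiregularityHigherSigma.lean`; the model `F` is quantified so that no transport of `σ_q` along `E⁰ ≅ F` is needed).
Same content as the venture's `Summit.Ventures.HSemireg.bfAdmissible`. [cite: BuchweitzFlenner2003, §5 (I-semiregular) and Thm. 5.1] -/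
def bfSingleAdmissible : PerfectAdmissibility := fun _ X₀ I E =>
  (∀ i : ℤ, i ≠ 0 → IsZero (E.X i)) ∧
    ∃ (F : X₀.left.Modules) (hF : IsFiniteLocallyFree F), Nonempty (E.X 0 ≅ F) ∧ IsISemiregular hF {q | q + 1 ∈ I}

/-- For a `bfSingleAdmissible` complex the Chern character is that of the model vector bundle `F` of its degree-`0` term:
`ch_k(E•) = ch_k(E⁰) = ch_k(F)`. [cite: Fulton1998, Example 3.2.3] -/
theorem chPerfect_eq_of_bfSingleAdmissible {E : CochainComplex X₀.left.Modules ℤ} (hE : IsBoundedVBComplex E)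
    (h0 : ∀ i : ℤ, i ≠ 0 → IsZero (E.X i)) {F : X₀.left.Modules} (e : E.X 0 ≅ F) (k : ℕ) :
    chPerfect C X₀ E hE.isFiniteLocallyFree k = C.ch X₀ F k := by
  rw [chPerfect_eq_ch_zero C X₀ E hE.isFiniteLocallyFree h0 k, C.ch_congr e]

/-- **An `I`-semiregular vector bundle `E₀` with a rational algebraic `B`-field `B₀` is a member**, for every notion
containing `bfSingleAdmissible`: `κ_p = (exp(B₀) ∪ ch(E₀))_p` (the tree's `expTwistCh`) for `p ∈ I` — the datum of Perry's
Thm. 1.1 for a finite locally free `E_0`, i.e. of the tree's `Perry2026_semiregularTwisted_remainsAlgebraic`. Witness: `E₀[0]`.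
[cite: Perry2026Semiregularity, Thm. 1.1 (hypotheses)] [cite: BuchweitzFlenner2003, §5 (I-semiregular)] -/
theorem twistedReflexiveClass_of_isISemiregular_twisted
    (hAdm : ∀ n X₀ I E, bfSingleAdmissible n X₀ I E → Adm n X₀ I E) (E₀ : X₀.left.Modules)
    (hE₀ : IsFiniteLocallyFree E₀) (hsr : IsISemiregular hE₀ {q | q + 1 ∈ I}) {B₀ : complexBetti X₀ 2}
    (hBr : IsRationalClass B₀) (hBa : B₀ ∈ algebraicClasses X₀ 1)
    (hκ : ∀ p ∈ I, κ p = expTwistCh C X₀ B₀ E₀ p) : twistedReflexiveClass C Adm n X₀ I κ := by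
  have hE : IsBoundedVBComplex ((HomologicalComplex.single _ (ComplexShape.up ℤ) 0).obj E₀) :=
    IsBoundedVBComplex.single E₀ hE₀ 0
  have h0 : ∀ i : ℤ, i ≠ 0 → IsZero (((HomologicalComplex.single _ (ComplexShape.up ℤ) 0).obj E₀).X i) :=
    fun i hi => HomologicalComplex.isZero_single_obj_X (ComplexShape.up ℤ) 0 E₀ i hi
  refine ⟨(HomologicalComplex.single _ (ComplexShape.up ℤ) 0).obj E₀, hE, B₀,
    hAdm _ _ _ _ ⟨h0, E₀, hE₀, ⟨HomologicalComplex.singleObjXSelf (ComplexShape.up ℤ) 0 E₀⟩, hsr⟩, hBr, hBa,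
    fun p hp => ?_⟩
  have hch : (fun j => chPerfect C X₀ _ hE.isFiniteLocallyFree j) = fun j => C.ch X₀ E₀ j :=
    funext fun j => chPerfect_single C X₀ E₀ hE₀ hE.isFiniteLocallyFree j
  rw [hκ p hp, hch, expTwistCh_eq_expTwistClasses]

/-- **The Buchweitz–Flenner slice**: an `I`-semiregular vector bundle `E₀` with `κ_p = ch_p(E₀)` for `p ∈ I` is a member
(`B₀ = 0`), for every notion containing `bfSingleAdmissible` — so the venture's sheaf class `bfSheafClass C` is contained in
`twistedReflexiveClass C Adm` (summit-side one-liner). [cite: BuchweitzFlenner2003, §5 (I-semiregular) and Thm. 5.1 (hypotheses)] -/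
theorem twistedReflexiveClass_of_isISemiregular
    (hAdm : ∀ n X₀ I E, bfSingleAdmissible n X₀ I E → Adm n X₀ I E) (E₀ : X₀.left.Modules)
    (hE₀ : IsFiniteLocallyFree E₀) (hsr : IsISemiregular hE₀ {q | q + 1 ∈ I})
    (hκ : ∀ p ∈ I, κ p = C.ch X₀ E₀ p) : twistedReflexiveClass C Adm n X₀ I κ :=
  twistedReflexiveClass_of_isISemiregular_twisted hAdm E₀ hE₀ hsr IsRationalClass.zero (Submodule.zero_mem _)
    fun p hp => by rw [expTwistCh_zero]; exact hκ p hp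

end ObjectClass

/-! ### §4 The local variational Hodge statement for the twisted-perfect door (definition item D2, named fact) -/

section Door

/-- **`TwistedPerfectDoorVHC C Adm` — THE LOCAL VARIATIONAL HODGE STATEMENT FOR THE TWISTED-PERFECT DOOR** (NAMED FACT,
D-0014, definition item `defn-TwistedPerfectDoorVHC`, D2 of road b02; users take `(h : TwistedPerfectDoorVHC C Adm)`). VERBATIM
the binders of the refereed tree fact `BuchweitzFlenner2003_variationalHodge_ISemiregular_model` (= of the venture's
`LocalVariationalHodgeFor 𝒪`) with the sheaf datum replaced by membership in `twistedReflexiveClass C Adm`: for every smooth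
projective family `π : 𝒳 ⟶ S` of relative dimension `n` over a smooth `ℂ`-scheme, cohomologically locally trivial
`U ⊆ S(ℂ)` with base point `s₀`, model `e : X₀ ≅ 𝒳_{s₀}`, finite set `I` of degrees and classes `κ` on `X₀` that are the
`B₀`-twisted Chern character, in the degrees `I`, of an ADMISSIBLE bounded complex of vector bundles `E` on `X₀` with a
rational algebraic `B`-field `B₀` — IF for every `p ∈ I` the flat transports of `(e⁻¹)^* κ_p` along all paths in `U` are of
type `(p,p)` («`w_0 = exp(B_0) · ch(E_0)` remains Hodge»), THEN on some open `W`, `s₀ ∈ W ⊆ U`, the transports of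
`(e⁻¹)^* κ_p` (`p ∈ I`) along paths inside `W` are ALGEBRAIC classes of the fibres («`w_0` remains algebraic», locally).
Summit-side, `TwistedPerfectDoorVHC C Adm ↔ LocalVariationalHodgeFor (twistedReflexiveClass C Adm)` is `Iff.rfl`.
HONEST LABELS (director-hodge 2026-08-25T23:06:49Z; vhodge-lit §124.c). For the INTENDED `Adm` (full/`I`-semiregularity of the
perfect complex, `Ext^{<0} = 0`): (a) REFEREED, INFINITESIMAL — [Pridham2024Semiregularity] Rem. 2.26 with Cor. 2.25 / Rem. 2.27:
the obstruction to deforming a `μ_r`-twisted perfect complex along an Artinian thickening dies exactly when its image under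
`σ_{p-1}` does; over the Hodge locus of a horizontal `(p,p)` lift this is the reduced obstruction theory `ker σ` — for a
semiregular object, unobstructed; the passage to an open neighbourhood is Hodge-free standard algebraisation (as in the
venture's split `PridhamPerfectLifts C` + `PerfectComplexAlgebraisesLifts C` for the untwisted door); (b) GLOBAL/ANALYTIC FORM,
PREPRINTS — [Markman2025SecantWeil] §7.3, statement 7.3.9, which §7.5.2 PROVES for families of abelian varieties (reduction to
BF Thm. 5.1 through a projective bundle, no derived geometry; not proved in print beyond the case where the Brauer class extends
over the family), and [Perry2026Semiregularity] Thm. 1.1 (2) (any smooth proper family; tree rendering for finite locally free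
`E_0`: `Perry2026_semiregularTwisted_remainsAlgebraic`); (c) CAVEAT — the comparison of Markman's `σ_𝓑` with Pridham's `𝓛` is
UNVERIFIED in print (Markman, footnote p. 6: «One needs to verify that our semiregularity map is injective, if and only if
Pridham's is»). For `Adm := bfSingleAdmissible` restricted to `B₀ = 0` the statement is Buchweitz–Flenner's refereed Thm. 5.1
(the tree fact); for `Adm := ⊤` (every complex admissible) it is NOT a published result and must not be instantiated so: a
consumer's theorem is exactly as strong as the notion it is fed. No declaration of the tree discharges this fact.
[cite: Pridham2024Semiregularity, Rem. 2.26 with Cor. 2.25 and Rem. 2.27]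
[cite: Markman2025SecantWeil, §7.3 statement 7.3.9 with §7.5.2 (proof for families of abelian varieties); footnote p. 6]
[cite: Perry2026Semiregularity, Thm. 1.1 (2) (preprint, under review)] [cite: BuchweitzFlenner2003, §5 Thm. 5.1 (binder shape)] -/
def TwistedPerfectDoorVHC (C : ChernCharacterBetti) (Adm : PerfectAdmissibility) : Prop :=
  ∀ ⦃𝒳 S : SchemeOver ℂ⦄ (π : 𝒳 ⟶ S) (n : ℕ),
    IsSmoothProjectiveFamily π n → _root_.AlgebraicGeometry.Smooth S.hom →
    ∀ ⦃U : Set (ComplexPoints S)⦄ (hU : IsCohomologicallyLocallyTrivialOn π U) (s₀ : U)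
      (X₀ : SchemeOver ℂ) (e : X₀ ≅ fiberOver π s₀.1) (I : Finset ℕ) (κ : (p : ℕ) → complexBetti X₀ (2 * p)),
      twistedReflexiveClass C Adm n X₀ I κ →
      (∀ p ∈ I, ∀ (t : U) (γ : Path.Homotopic.Quotient s₀ t),
          IsOfHodgeType n (fiberOver π t.1) (2 * p) p p
            (transportFun π (2 * p) hU γ (complexBetti.map e.inv (2 * p) (κ p)))) →
      ∃ (W : Set (ComplexPoints S)) (hWo : IsOpen W) (hW₀ : s₀.1 ∈ W) (hWU : W ⊆ U),
        ∀ p ∈ I, ∀ (t : W) (γ : Path.Homotopic.Quotient (⟨s₀.1, hW₀⟩ : W) t),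
          transportFun π (2 * p) (hU.mono hWU hWo) γ (complexBetti.map e.inv (2 * p) (κ p)) ∈
            algebraicClasses (fiberOver π t.1) p

/-- **Antitonicity in the admissibility notion**: the statement for a WEAKER notion `Adm'` (more admissible complexes, a
larger door) implies the statement for every stronger notion `Adm` — a transfer theorem for a wider class of objects serves
every narrower door (formal bookkeeping on the binder shape of Buchweitz–Flenner's Thm. 5.1).
[cite: BuchweitzFlenner2003, §5 Thm. 5.1 (binder shape)] -/
theorem TwistedPerfectDoorVHC.anti {C : ChernCharacterBetti} {Adm Adm' : PerfectAdmissibility}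
    (hle : ∀ n X₀ I E, Adm n X₀ I E → Adm' n X₀ I E) (h : TwistedPerfectDoorVHC C Adm') :
    TwistedPerfectDoorVHC C Adm :=
  fun _ _ π n hπ hS _ hU s₀ X₀ e I κ hκ hHodge => h π n hπ hS hU s₀ X₀ e I κ (hκ.mono hle) hHodge

/-- **The untwisted Buchweitz–Flenner content of the door**: `TwistedPerfectDoorVHC C Adm`, for any notion containing
`bfSingleAdmissible`, IMPLIES the refereed tree fact's conclusion for `I`-semiregular vector bundles in the given Chern
character theory `C` (the `B₀ = 0`, single-sheaf slice) — recorded so that reviewers see the fact is a WIDENING of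
`BuchweitzFlenner2003_variationalHodge_ISemiregular_model` at `C`, binder for binder. [cite: BuchweitzFlenner2003, §5 Thm. 5.1] -/
theorem TwistedPerfectDoorVHC.bf_slice {C : ChernCharacterBetti} {Adm : PerfectAdmissibility}
    (hAdm : ∀ n X₀ I E, bfSingleAdmissible n X₀ I E → Adm n X₀ I E) (h : TwistedPerfectDoorVHC C Adm)
    ⦃𝒳 S : SchemeOver ℂ⦄ (π : 𝒳 ⟶ S) (n : ℕ) (hπ : IsSmoothProjectiveFamily π n)
    (hS : _root_.AlgebraicGeometry.Smooth S.hom) ⦃U : Set (ComplexPoints S)⦄ (hU : IsCohomologicallyLocallyTrivialOn π U)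
    (s₀ : U) (X₀ : SchemeOver ℂ) (e : X₀ ≅ fiberOver π s₀.1) (E₀ : X₀.left.Modules) (hE₀ : IsFiniteLocallyFree E₀)
    (I : Finset ℕ) (hsr : IsISemiregular hE₀ {q | q + 1 ∈ I})
    (hHodge : ∀ p ∈ I, ∀ (t : U) (γ : Path.Homotopic.Quotient s₀ t),
      IsOfHodgeType n (fiberOver π t.1) (2 * p) p p
        (transportFun π (2 * p) hU γ (complexBetti.map e.inv (2 * p) (C.ch X₀ E₀ p)))) :
    ∃ (W : Set (ComplexPoints S)) (hWo : IsOpen W) (hW₀ : s₀.1 ∈ W) (hWU : W ⊆ U),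
      ∀ p ∈ I, ∀ (t : W) (γ : Path.Homotopic.Quotient (⟨s₀.1, hW₀⟩ : W) t),
        transportFun π (2 * p) (hU.mono hWU hWo) γ (complexBetti.map e.inv (2 * p) (C.ch X₀ E₀ p)) ∈
          algebraicClasses (fiberOver π t.1) p :=
  h π n hπ hS hU s₀ X₀ e I (fun p => C.ch X₀ E₀ p)
    (twistedReflexiveClass_of_isISemiregular hAdm E₀ hE₀ hsr fun _ _ => rfl) hHodge

end Door

end Literature.AlgebraicGeometry.HodgeTheory

end
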